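import Mathlib
import Summits.QuantumFields.BalabanUV.Beta.UnitLatticeDecoratedChains

/-!
# `Summit.QuantumFields.BalabanUV.Beta.UnitLatticeTubeCount` — A3-loc (iii): THE TUBE COUNT — a chain of cube
# neighbourhoods `□̃_{b₀}, …, □̃_{b_n}` (each of diameter `≤ D`) threaded by a point chain `y₀, …, y_n` (`y_t ∈ □̃_{b_t}`)
# meets at most `P·(1 + pathLen(y)/r)` decoration cells, `P` = the packing number of the cells at radius `r + D`;
# per TERM, not per step — in the PATH-LENGTH currency of [13] (3.93)

HONEST FRAMING (page 1 of everything in this cell).  Discharging `FlowStep.BetaPertH` would make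
Bałaban's ultraviolet stability UNCONDITIONAL — a constructive-QFT result; it is NOT the continuum
limit and NOT the Clay problem.  This module discharges nothing of `BetaPertH`; [folklore] metric combinatorics,
kernel-checked (unit `b2b-balaban-beta-d4-p3`, road P3, gen 4; leaf A3-loc (iii) of skeleton v1.8 §7.4–§7.5 = the
hypothesis `htube` of `UnitLatticeDecoratedResolvent.wrs_decSum`, in the corrected currency — see FINDING).
HONEST DEPENDENCY: continuum YM on T⁴ ⇐ BetaPertH ∧ nine spine estimates (0/9 proved); BetaPertH ⇐
(D1) ∧ (D4) ∧ CAP+tail; G-an2-4 gates asym, D1 and NE2/3/4.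

CONTEXT (located, NOT used as hypotheses).  [II] = T. Bałaban, CMP **116** (1988) p. 3: *"for a random walk ω
localized in X̃₀⁵ ∪ X̃₁⁵ ∪ ⋯ ∪ X̃_n⁵ we take the {Δ₁, …, Δ_m} of all cubes from σ₀ which intersect this localization
domain, and we multiply the term … by s(Δ₁)⋯s(Δ_m)"*; p. 5 after (1.11): *"If m is big enough, for example m > 2⁴,
then δ₀d(ω) ≧ δ₁mM"*; [13] = CMP **99** (1985) p. 410 (3.93): the walk length as an infimum over ONE POINT PER DOMAIN
IN WALK ORDER.  The tree's continuum twin is `B13WalkCubes111.card_le_of_nearAdmissible` (|Y| ≤ 2^d·max(1, |T|/ρ)).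

FINDING (on this lineage's own gen-3 hypothesis SHAPE, recorded honestly).  `UnitLatticeDecoratedResolvent.wrs_decSum`
asks for `#dec(b⃗) ≤ c₀ + c₁·sepSum(b⃗)/M_d` with `sep(b,b′) ≤ d(k,l)` on `□̃_b × □̃_{b′}` — so `sep = 0` between
OVERLAPPING neighbour cubes, and a walk of `n` steps through successively adjacent cubes has `sepSum = 0` while meeting
`≍ n·M_w/M_d` cells: in that currency a per-step allowance is unavoidable (`card_tubeDec_le_sepSum` below displays it,
`+ (4ρP/r)·n`).  In the PATH currency (one point per cube in walk order, `pathLen`) the count is per TERM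
(`card_tubeDec_le`), exactly as in [13] (3.93) ∕ [II] (1.11); the matching (iv)-core with credit on EVERY index link is
`UnitLatticeDecoratedPaths` (this gen).

CONTENTS (0 sorry).
* §1 `pathLen d n y` (the length of a point chain, `Fin.init` recursion as `sepSum`), `pathLen_snoc`, `pathLen_nonneg`.
* §2 **`exists_anchors`** (greedy net on an abstract pseudo-metric — triangle inequality and `d(y,y) = 0` only): a chain
  admits anchors `A ⊆ {indices}`, every point within `r` of an anchor, and `(#A − 1)·r ≤ pathLen`.
* §3 cells as a LABELLING `cellOf : Y → Δ`; PACKING at radius `R`: every `R`-ball meets `≤ P` cells;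
  **`card_le_of_chain`** and `tubeDec` (the cells met by `⋃_t □̃_{b_t}`) with **`card_tubeDec_le`**:
  `#tubeDec ≤ P·(1 + pathLen(y)/r)` for EVERY admissible chain `y` (`r + D ≤ R`); `card_tubeDec_le'` in the letters
  `c₀ + c₁·ℓ/M_d` (`c₀ = P`, `c₁ = P·M_d/r`).
* §4 the sepSum currency: centre separation `ctrSep` (satisfies the gen-3 hypotheses `hsep0`, `hsep`),
  `pathLen_le_sepSum_add` (`pathLen ≤ sepSum + 4ρ·n`), `card_tubeDec_le_sepSum` (the per-step term displayed).
* §5 the model `ℤ^ν`, sup-distance `supDist`, cells of side `M` (`gridCellOf M z = ⌊z/M⌋` coordinatewise):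
  **`gridCell_packing`** (`2R ≤ M` ⟹ every `R`-ball meets `≤ 2^ν` cells — the printed 2⁴) and its pull-back to any
  `Y` mapped into `ℤ^ν` (`packing_comap`); `weightHyp_supDistOn`.
NOT HERE: the decorated-sum bound itself (`UnitLatticeDecoratedPaths`), the torus-periodic cell model, any instance on
Bałaban's operators.  NOT summit progress.
-/

open scoped BigOperators
open Finset

namespace Summit.QuantumFields.BalabanUV.Beta.UnitLatticeTubeCount

open Summit.QuantumFields.BalabanUV.Beta.UnitLatticeDecoratedChains (sepSum)
open Literature.MathematicalPhysics.QuantumFieldTheory.Balaban1983to89.B13PerturbativeStep (WeightHyp)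

noncomputable section

variable {Y : Type*} {B : Type*}

/-! ## §1 The length of a point chain -/

/-- The LENGTH of a point chain `y₀, …, y_n`: `Σ_t d(y_{t−1}, y_t)` (recursion on `n`, last link split off —
the recursion pattern of `UnitLatticeDecoratedChains.sepSum`). [folklore] -/
def pathLen (d : Y → Y → ℝ) : (n : ℕ) → (Fin (n + 1) → Y) → ℝ
  | 0, _ => 0
  | n + 1, y => pathLen d n (Fin.init y) + d (y (Fin.last n).castSucc) (y (Fin.last (n + 1)))

/-- A one-point chain has length `0`. [folklore] -/
theorem pathLen_zero (d : Y → Y → ℝ) (y : Fin 1 → Y) : pathLen d 0 y = 0 := rfl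

/-- Unfolding the recursion. [folklore] -/
theorem pathLen_succ (d : Y → Y → ℝ) (n : ℕ) (y : Fin (n + 2) → Y) :
    pathLen d (n + 1) y = pathLen d n (Fin.init y) + d (y (Fin.last n).castSucc) (y (Fin.last (n + 1))) := rfl

/-- Unfolding at a snoc-extended chain. [folklore] -/
theorem pathLen_snoc (d : Y → Y → ℝ) (n : ℕ) (y : Fin (n + 1) → Y) (z : Y) :
    pathLen d (n + 1) (Fin.snoc y z) = pathLen d n y + d (y (Fin.last n)) z := by
  rw [pathLen_succ, Fin.init_snoc, Fin.snoc_last, Fin.snoc_castSucc]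

/-- `pathLen ≥ 0` for a nonnegative `d`. [folklore] -/
theorem pathLen_nonneg (d : Y → Y → ℝ) (hd : ∀ a b, 0 ≤ d a b) :
    ∀ (n : ℕ) (y : Fin (n + 1) → Y), 0 ≤ pathLen d n y
  | 0, _ => le_rfl
  | n + 1, _ => add_nonneg (pathLen_nonneg d hd n _) (hd _ _)

/-! ## §2 Anchors: a greedy `r`-net along the chain -/

/-- **ANCHORS.**  On an abstract pseudo-metric (`d(a,c) ≤ d(a,b) + d(b,c)`, `d(a,a) = 0`; no symmetry needed), every
point chain `y₀, …, y_n` admits a set `A` of anchor indices with a distinguished LAST anchor `a ∈ A` such that every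
`y_t` lies within `r` of some anchor (`d(y_s, y_t) ≤ r`, anchor first) and `(#A − 1)·r + d(y_a, y_n) ≤ pathLen(y)`
(greedy: a new anchor is opened exactly when the chain leaves the `r`-ball of the last one; consecutive anchors are
then `> r` apart ALONG the chain, and the chain length pays for them by the triangle inequality). [folklore] -/
theorem exists_anchors (d : Y → Y → ℝ) (htri : ∀ a b c, d a c ≤ d a b + d b c) (hzero : ∀ a, d a a = 0)
    {r : ℝ} (hr : 0 ≤ r) :
    ∀ (n : ℕ) (y : Fin (n + 1) → Y), ∃ (A : Finset (Fin (n + 1))) (a : Fin (n + 1)), a ∈ A ∧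
      (∀ t, ∃ s ∈ A, d (y s) (y t) ≤ r) ∧
      ((A.card : ℝ) - 1) * r + d (y a) (y (Fin.last n)) ≤ pathLen d n y
  | 0, y => by
      refine ⟨{0}, 0, Finset.mem_singleton_self 0, fun t => ⟨0, Finset.mem_singleton_self 0, ?_⟩, ?_⟩
      · have ht : t = 0 := Fin.ext (by have := t.isLt; omega)
        rw [ht, hzero]
        exact hr
      · have h0 : Fin.last 0 = 0 := rfl
        rw [Finset.card_singleton, h0, hzero, pathLen_zero]
        simp
  | n + 1, y => by
      obtain ⟨A₀, a₀, ha₀, hcov, hinv⟩ := exists_anchors d htri hzero hr n (Fin.init y)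
      -- the anchors of the prefix, re-indexed into `Fin (n + 2)`
      have hmemA₁ : ∀ s ∈ A₀, s.castSucc ∈ A₀.map Fin.castSuccEmb := fun s hs =>
        Finset.mem_map.2 ⟨s, hs, rfl⟩
      have hcardA₁ : (A₀.map Fin.castSuccEmb).card = A₀.card := Finset.card_map _
      have hcov' : ∀ t : Fin (n + 2), t ≠ Fin.last (n + 1) → ∃ s ∈ A₀.map Fin.castSuccEmb, d (y s) (y t) ≤ r := by
        intro t ht
        obtain ⟨t', rfl⟩ : ∃ t' : Fin (n + 1), t = t'.castSucc := by
          rcases Fin.eq_castSucc_or_eq_last t with ⟨t', rfl⟩ | rfl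
          · exact ⟨t', rfl⟩
          · exact absurd rfl ht
        obtain ⟨s, hs, hd⟩ := hcov t'
        exact ⟨s.castSucc, hmemA₁ s hs, hd⟩
      -- the chain inequality carried to the new end point
      have hchain : ((A₀.card : ℝ) - 1) * r + d (y a₀.castSucc) (y (Fin.last (n + 1))) ≤ pathLen d (n + 1) y := by
        have ht := htri (y a₀.castSucc) (y (Fin.last n).castSucc) (y (Fin.last (n + 1)))
        change ((A₀.card : ℝ) - 1) * r + d (y a₀.castSucc) (y (Fin.last n).castSucc) ≤ pathLen d n (Fin.init y)
          at hinv
        rw [pathLen_succ]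
        linarith
      by_cases hnear : d (y a₀.castSucc) (y (Fin.last (n + 1))) ≤ r
      · -- the new point stays in the ball of the last anchor
        refine ⟨A₀.map Fin.castSuccEmb, a₀.castSucc, hmemA₁ a₀ ha₀, fun t => ?_, ?_⟩
        · by_cases ht : t = Fin.last (n + 1)
          · exact ⟨a₀.castSucc, hmemA₁ a₀ ha₀, by rw [ht]; exact hnear⟩
          · exact hcov' t ht
        · rw [hcardA₁]
          exact hchain
      · -- a new anchor is opened at the new point
        refine ⟨insert (Fin.last (n + 1)) (A₀.map Fin.castSuccEmb), Fin.last (n + 1), Finset.mem_insert_self _ _,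
          fun t => ?_, ?_⟩
        · by_cases ht : t = Fin.last (n + 1)
          · exact ⟨Fin.last (n + 1), Finset.mem_insert_self _ _, by rw [ht, hzero]; exact hr⟩
          · obtain ⟨s, hs, hd⟩ := hcov' t ht
            exact ⟨s, Finset.mem_insert_of_mem hs, hd⟩
        · have hnot : Fin.last (n + 1) ∉ A₀.map Fin.castSuccEmb := by
            intro h
            obtain ⟨s, _, hs⟩ := Finset.mem_map.1 h
            rw [Fin.castSuccEmb_apply] at hs
            exact (Fin.castSucc_lt_last s).ne hs
          rw [Finset.card_insert_of_notMem hnot, hcardA₁, hzero]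
          push_cast
          linarith [not_le.1 hnear]

/-! ## §3 Cells, packing, and the count -/

/-- **THE COUNT.**  Cells as a labelling `cellOf : Y → Δ`; PACKING at radius `R`: every `R`-ball meets at most `P`
cells; cube neighbourhoods `□̃_b = E b` of diameter `≤ D`; an admissible point chain `y_t ∈ □̃_{b_t}`; `0 < r`,
`r + D ≤ R`.  Then every finite set `T` of cells each met by some `□̃_{b_t}` has `#T ≤ P·(1 + pathLen(y)/r)`:
each such cell lies within `R` of an anchor (anchor → `y_t` ≤ `r`, `y_t` → the meeting point ≤ `D`), there are
`≤ 1 + pathLen/r` anchors, each sees `≤ P` cells. [folklore] -/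
theorem card_le_of_chain (d : Y → Y → ℝ) (htri : ∀ a b c, d a c ≤ d a b + d b c) (hzero : ∀ a, d a a = 0)
    (hnn : ∀ a b, 0 ≤ d a b) {r D R : ℝ} (hr : 0 < r) (hRD : r + D ≤ R) {Δ : Type*} [DecidableEq Δ]
    (cellOf : Y → Δ) {P : ℕ} (hpack : ∀ a : Y, ∃ S : Finset Δ, S.card ≤ P ∧ ∀ z, d a z ≤ R → cellOf z ∈ S)
    (E : B → Finset Y) (hdiam : ∀ b, ∀ z ∈ E b, ∀ z' ∈ E b, d z z' ≤ D)
    {n : ℕ} (bs : Fin (n + 1) → B) (y : Fin (n + 1) → Y) (hy : ∀ t, y t ∈ E (bs t))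
    (T : Finset Δ) (hT : ∀ δ ∈ T, ∃ t, ∃ z ∈ E (bs t), cellOf z = δ) :
    (T.card : ℝ) ≤ P * (1 + pathLen d n y / r) := by
  obtain ⟨A, a, _, hcov, hinv⟩ := exists_anchors d htri hzero hr.le n y
  choose S hS using hpack
  have hsub : T ⊆ A.biUnion fun s => S (y s) := by
    intro δ hδ
    obtain ⟨t, z, hz, hzc⟩ := hT δ hδ
    obtain ⟨s, hs, hst⟩ := hcov t
    refine Finset.mem_biUnion.2 ⟨s, hs, ?_⟩
    rw [← hzc]
    refine (hS (y s)).2 z ?_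
    calc d (y s) z ≤ d (y s) (y t) + d (y t) z := htri _ _ _
      _ ≤ r + D := add_le_add hst (hdiam (bs t) (y t) (hy t) z hz)
      _ ≤ R := hRD
  have hcardA : (A.card : ℝ) ≤ 1 + pathLen d n y / r := by
    have h1 : ((A.card : ℝ) - 1) * r ≤ pathLen d n y := by linarith [hnn (y a) (y (Fin.last n))]
    have h2 : (A.card : ℝ) - 1 ≤ pathLen d n y / r := by rwa [le_div_iff₀ hr]
    linarith
  calc (T.card : ℝ) ≤ ((A.biUnion fun s => S (y s)).card : ℝ) := by exact_mod_cast Finset.card_le_card hsub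
    _ ≤ ((∑ s ∈ A, (S (y s)).card : ℕ) : ℝ) := by exact_mod_cast Finset.card_biUnion_le
    _ = ∑ s ∈ A, ((S (y s)).card : ℝ) := by push_cast; rfl
    _ ≤ ∑ _s ∈ A, (P : ℝ) := Finset.sum_le_sum fun s _ => by exact_mod_cast (hS (y s)).1
    _ = A.card * P := by rw [Finset.sum_const, nsmul_eq_mul]
    _ ≤ (1 + pathLen d n y / r) * P := mul_le_mul_of_nonneg_right hcardA (Nat.cast_nonneg P)
    _ = P * (1 + pathLen d n y / r) := mul_comm _ _

/-- THE DECORATION of a cube sequence: the cells met by `⋃_t □̃_{b_t}` ([II] p. 3: *"all cubes from σ₀ which intersect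
this localization domain"*, for the localisation domain of a unit-lattice walk term). [folklore] -/
def tubeDec {Δ : Type*} [DecidableEq Δ] (cellOf : Y → Δ) (E : B → Finset Y) (n : ℕ) (bs : Fin (n + 1) → B) :
    Finset Δ :=
  Finset.univ.biUnion fun t => (E (bs t)).image cellOf

/-- Membership in the decoration. [folklore] -/
theorem mem_tubeDec {Δ : Type*} [DecidableEq Δ] (cellOf : Y → Δ) (E : B → Finset Y) (n : ℕ)
    (bs : Fin (n + 1) → B) (δ : Δ) : δ ∈ tubeDec cellOf E n bs ↔ ∃ t, ∃ z ∈ E (bs t), cellOf z = δ := by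
  simp [tubeDec]

/-- The cell of any point of any `□̃_{b_t}` is in the decoration. [folklore] -/
theorem cellOf_mem_tubeDec {Δ : Type*} [DecidableEq Δ] (cellOf : Y → Δ) (E : B → Finset Y) (n : ℕ)
    (bs : Fin (n + 1) → B) (t : Fin (n + 1)) {z : Y} (hz : z ∈ E (bs t)) : cellOf z ∈ tubeDec cellOf E n bs :=
  (mem_tubeDec cellOf E n bs _).2 ⟨t, z, hz, rfl⟩

/-- **THE TUBE COUNT (path currency)**: `#tubeDec(b⃗) ≤ P·(1 + pathLen(y)/r)` for EVERY admissible point chain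
`y_t ∈ □̃_{b_t}` — a per-TERM constant `P` and a slope `P/r`, NO per-step term. [folklore] -/
theorem card_tubeDec_le (d : Y → Y → ℝ) (htri : ∀ a b c, d a c ≤ d a b + d b c) (hzero : ∀ a, d a a = 0)
    (hnn : ∀ a b, 0 ≤ d a b) {r D R : ℝ} (hr : 0 < r) (hRD : r + D ≤ R) {Δ : Type*} [DecidableEq Δ]
    (cellOf : Y → Δ) {P : ℕ} (hpack : ∀ a : Y, ∃ S : Finset Δ, S.card ≤ P ∧ ∀ z, d a z ≤ R → cellOf z ∈ S)
    (E : B → Finset Y) (hdiam : ∀ b, ∀ z ∈ E b, ∀ z' ∈ E b, d z z' ≤ D)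
    {n : ℕ} (bs : Fin (n + 1) → B) (y : Fin (n + 1) → Y) (hy : ∀ t, y t ∈ E (bs t)) :
    ((tubeDec cellOf E n bs).card : ℝ) ≤ P * (1 + pathLen d n y / r) :=
  card_le_of_chain d htri hzero hnn hr hRD cellOf hpack E hdiam bs y hy _
    fun δ hδ => (mem_tubeDec cellOf E n bs δ).1 hδ

/-- The same in the letters `c₀ + c₁·ℓ/M_d` of `UnitLatticeDecoratedResolvent` (`c₀ = P`, `c₁ = P·M_d/r`). [folklore] -/
theorem card_tubeDec_le' (d : Y → Y → ℝ) (htri : ∀ a b c, d a c ≤ d a b + d b c) (hzero : ∀ a, d a a = 0)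
    (hnn : ∀ a b, 0 ≤ d a b) {r D R : ℝ} (hr : 0 < r) (hRD : r + D ≤ R) {Δ : Type*} [DecidableEq Δ]
    (cellOf : Y → Δ) {P : ℕ} (hpack : ∀ a : Y, ∃ S : Finset Δ, S.card ≤ P ∧ ∀ z, d a z ≤ R → cellOf z ∈ S)
    (E : B → Finset Y) (hdiam : ∀ b, ∀ z ∈ E b, ∀ z' ∈ E b, d z z' ≤ D) {Md : ℝ} (hMd : 0 < Md)
    {n : ℕ} (bs : Fin (n + 1) → B) (y : Fin (n + 1) → Y) (hy : ∀ t, y t ∈ E (bs t)) :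
    ((tubeDec cellOf E n bs).card : ℝ) ≤ P + (P * Md / r) * pathLen d n y / Md := by
  have h := card_tubeDec_le d htri hzero hnn hr hRD cellOf hpack E hdiam bs y hy
  have hMd' : (Md : ℝ) ≠ 0 := hMd.ne'
  have h1 : (P * Md / r) * pathLen d n y / Md = (P / r * pathLen d n y) * (Md / Md) := by ring
  rw [h1, div_self hMd', mul_one]
  have h2 : (P : ℝ) * (1 + pathLen d n y / r) = P + P / r * pathLen d n y := by ring
  linarith

/-! ## §4 The sepSum currency: centre separation and the per-step term -/

/-- CENTRE SEPARATION of two cubes: `max{0, d(ctr b, ctr b′) − 2ρ}` (`ρ` = radius of `□̃` about its centre). [folklore] -/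
def ctrSep (d : Y → Y → ℝ) (ctr : B → Y) (ρ : ℝ) (b b' : B) : ℝ := max 0 (d (ctr b) (ctr b') - 2 * ρ)

/-- `ctrSep ≥ 0` (hypothesis `hsep0` of the gen-3 chain estimates). [folklore] -/
theorem ctrSep_nonneg (d : Y → Y → ℝ) (ctr : B → Y) (ρ : ℝ) (b b' : B) : 0 ≤ ctrSep d ctr ρ b b' :=
  le_max_left _ _

/-- `d(ctr b, ctr b′) ≤ ctrSep(b,b′) + 2ρ`. [folklore] -/
theorem dist_ctr_le_ctrSep_add (d : Y → Y → ℝ) (ctr : B → Y) (ρ : ℝ) (b b' : B) :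
    d (ctr b) (ctr b') ≤ ctrSep d ctr ρ b b' + 2 * ρ := by
  have := le_max_right 0 (d (ctr b) (ctr b') - 2 * ρ)
  rw [ctrSep]
  linarith

/-- `ctrSep(b,b′) ≤ d(k,l)` for `k ∈ □̃_b`, `l ∈ □̃_{b′}` (hypothesis `hsep` of the gen-3 chain estimates), when every point
of `□̃_b` is within `ρ` of the centre in both orientations. [folklore] -/
theorem ctrSep_le (d : Y → Y → ℝ) (htri : ∀ a b c, d a c ≤ d a b + d b c) (hnn : ∀ a b, 0 ≤ d a b) (ctr : B → Y)
    {ρ : ℝ} (E : B → Finset Y) (hctr : ∀ b, ∀ z ∈ E b, d (ctr b) z ≤ ρ ∧ d z (ctr b) ≤ ρ) {b b' : B} {k l : Y}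
    (hk : k ∈ E b) (hl : l ∈ E b') : ctrSep d ctr ρ b b' ≤ d k l := by
  refine max_le (hnn k l) ?_
  have h1 := htri (ctr b) k (ctr b')
  have h2 := htri k l (ctr b')
  linarith [(hctr b k hk).1, (hctr b' l hl).2]

/-- **`pathLen ≤ sepSum + 4ρ·n`**: an admissible chain's links are at most `ctrSep + 4ρ` each — the per-step `4ρ`
is what the sepSum currency does not see. [folklore] -/
theorem pathLen_le_sepSum_add (d : Y → Y → ℝ) (htri : ∀ a b c, d a c ≤ d a b + d b c) (ctr : B → Y) {ρ : ℝ}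
    (E : B → Finset Y) (hctr : ∀ b, ∀ z ∈ E b, d (ctr b) z ≤ ρ ∧ d z (ctr b) ≤ ρ) :
    ∀ (n : ℕ) (bs : Fin (n + 1) → B) (y : Fin (n + 1) → Y), (∀ t, y t ∈ E (bs t)) →
      pathLen d n y ≤ sepSum (ctrSep d ctr ρ) n bs + 4 * ρ * n
  | 0, bs, y, _ => by simp [pathLen, sepSum]
  | n + 1, bs, y, hy => by
      rw [pathLen_succ, sepSum]
      have ih := pathLen_le_sepSum_add d htri ctr E hctr n (Fin.init bs) (Fin.init y) fun t => hy t.castSucc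
      have hk := (hctr (bs (Fin.last n).castSucc) (y (Fin.last n).castSucc) (hy _)).2
      have hl := (hctr (bs (Fin.last (n + 1))) (y (Fin.last (n + 1))) (hy _)).1
      have h1 := htri (y (Fin.last n).castSucc) (ctr (bs (Fin.last n).castSucc)) (y (Fin.last (n + 1)))
      have h2 := htri (ctr (bs (Fin.last n).castSucc)) (ctr (bs (Fin.last (n + 1)))) (y (Fin.last (n + 1)))
      have h3 := dist_ctr_le_ctrSep_add d ctr ρ (bs (Fin.last n).castSucc) (bs (Fin.last (n + 1)))
      push_cast
      change pathLen d n (Fin.init y) + _ ≤ sepSum (ctrSep d ctr ρ) n (Fin.init bs)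
        + ctrSep d ctr ρ (bs (Fin.last n).castSucc) (bs (Fin.last (n + 1))) + 4 * ρ * (n + 1)
      linarith

/-- **THE TUBE COUNT (sepSum currency)**: `#tubeDec(b⃗) ≤ P·(1 + (sepSum(b⃗) + 4ρ·n)/r)` — the per-step term
`(4ρP/r)·n` made explicit (it is `≍ M_w/M_d` per step in the two-scale model, never zero). [folklore] -/
theorem card_tubeDec_le_sepSum (d : Y → Y → ℝ) (htri : ∀ a b c, d a c ≤ d a b + d b c) (hzero : ∀ a, d a a = 0)
    (hnn : ∀ a b, 0 ≤ d a b) {r D R ρ : ℝ} (hr : 0 < r) (hRD : r + D ≤ R) {Δ : Type*} [DecidableEq Δ]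
    (cellOf : Y → Δ) {P : ℕ} (hpack : ∀ a : Y, ∃ S : Finset Δ, S.card ≤ P ∧ ∀ z, d a z ≤ R → cellOf z ∈ S)
    (E : B → Finset Y) (hdiam : ∀ b, ∀ z ∈ E b, ∀ z' ∈ E b, d z z' ≤ D) (ctr : B → Y)
    (hctr : ∀ b, ∀ z ∈ E b, d (ctr b) z ≤ ρ ∧ d z (ctr b) ≤ ρ)
    {n : ℕ} (bs : Fin (n + 1) → B) (y : Fin (n + 1) → Y) (hy : ∀ t, y t ∈ E (bs t)) :
    ((tubeDec cellOf E n bs).card : ℝ) ≤ P * (1 + (sepSum (ctrSep d ctr ρ) n bs + 4 * ρ * n) / r) := by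
  refine (card_tubeDec_le d htri hzero hnn hr hRD cellOf hpack E hdiam bs y hy).trans ?_
  have hP : (0 : ℝ) ≤ P := Nat.cast_nonneg P
  have hmono : pathLen d n y / r ≤ (sepSum (ctrSep d ctr ρ) n bs + 4 * ρ * n) / r :=
    div_le_div_of_nonneg_right (pathLen_le_sepSum_add d htri ctr E hctr n bs y hy) hr.le
  exact mul_le_mul_of_nonneg_left (by linarith) hP

/-! ## §5 The model `ℤ^ν`: sup-distance, cells of side `M`, the packing number `2^ν` -/

section Grid

variable {ν : ℕ}

/-- The sup-distance on `ℤ^ν`, as a natural number. [folklore] -/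
def supDist (z z' : Fin ν → ℤ) : ℕ := Finset.univ.sup fun i => (z i - z' i).natAbs

/-- `supDist z z′ ≤ R ↔ |z_i − z′_i| ≤ R` for every coordinate. [folklore] -/
theorem supDist_le_iff {z z' : Fin ν → ℤ} {R : ℕ} : supDist z z' ≤ R ↔ ∀ i, (z i - z' i).natAbs ≤ R := by
  simp [supDist, Finset.sup_le_iff]

/-- `supDist z z = 0`. [folklore] -/
theorem supDist_self (z : Fin ν → ℤ) : supDist z z = 0 := by
  simp [supDist]

/-- Triangle inequality for `supDist`. [folklore] -/
theorem supDist_triangle (z z' z'' : Fin ν → ℤ) : supDist z z'' ≤ supDist z z' + supDist z' z'' := by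
  rw [supDist_le_iff]
  intro i
  have h1 : (z i - z' i).natAbs ≤ supDist z z' := (supDist_le_iff.1 le_rfl) i
  have h2 : (z' i - z'' i).natAbs ≤ supDist z' z'' := (supDist_le_iff.1 le_rfl) i
  have h3 : (z i - z'' i).natAbs ≤ (z i - z' i).natAbs + (z' i - z'' i).natAbs := by
    have : z i - z'' i = (z i - z' i) + (z' i - z'' i) := by ring
    rw [this]
    exact Int.natAbs_add_le _ _
  omega

/-- The sup-distance pulled back along a map `e : Y → ℤ^ν`, real-valued. [folklore] -/
def supDistOn (e : Y → (Fin ν → ℤ)) (a b : Y) : ℝ := (supDist (e a) (e b) : ℝ)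

/-- `supDistOn e` satisfies the weight hypotheses of the chain estimates (`B13PerturbativeStep.WeightHyp`) at every
rate `κ ≥ 0`. [folklore] -/
theorem weightHyp_supDistOn (e : Y → (Fin ν → ℤ)) {κ : ℝ} (hκ : 0 ≤ κ) : WeightHyp κ (supDistOn e) where
  κ_nonneg := hκ
  zero a := by simp [supDistOn, supDist_self]
  nonneg a b := Nat.cast_nonneg _
  tri a b c := by
    have := supDist_triangle (e a) (e b) (e c)
    unfold supDistOn
    exact_mod_cast this

/-- The CELL LABEL of a point for the partition of `ℤ^ν` into cubes of side `M`: `⌊z_i/M⌋` coordinatewise. [folklore] -/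
def gridCellOf (M : ℕ) (z : Fin ν → ℤ) : Fin ν → ℤ := fun i => z i / (M : ℤ)

/-- **PACKING of the `M`-grid**: if `2R ≤ M`, the cells met by the sup-ball of radius `R` about any point `a` lie in an
explicit set of at most `2^ν` labels (coordinatewise `⌊(a_i − R)/M⌋ ≤ ⌊z_i/M⌋ ≤ ⌊(a_i + R)/M⌋ ≤ ⌊(a_i − R)/M⌋ + 1`) —
the source of the printed 2⁴ of [II] p. 5. [folklore] -/
theorem gridCell_packing {M R : ℕ} (hM : 0 < M) (h2R : 2 * R ≤ M) (a : Fin ν → ℤ) :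
    ∃ S : Finset (Fin ν → ℤ), S.card ≤ 2 ^ ν ∧ ∀ z, supDist a z ≤ R → gridCellOf M z ∈ S := by
  have hM' : (0 : ℤ) < M := by exact_mod_cast hM
  refine ⟨Fintype.piFinset fun i => Finset.Icc ((a i - R) / (M : ℤ)) ((a i + R) / (M : ℤ)), ?_, ?_⟩
  · rw [Fintype.card_piFinset]
    calc ∏ i, (Finset.Icc ((a i - R) / (M : ℤ)) ((a i + R) / (M : ℤ))).card ≤ ∏ _i : Fin ν, 2 :=
          Finset.prod_le_prod' fun i _ => by
            rw [Int.card_Icc]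
            have h1 : (a i + R) / (M : ℤ) ≤ (a i - R) / (M : ℤ) + 1 := by
              have h := Int.ediv_le_ediv hM' (show a i + R ≤ a i - R + 1 * (M : ℤ) by omega)
              rwa [Int.add_mul_ediv_right _ _ hM'.ne'] at h
            omega
      _ = 2 ^ ν := by simp
  · intro z hz
    rw [Fintype.mem_piFinset]
    intro i
    rw [Finset.mem_Icc, gridCellOf]
    have habs : (a i - z i).natAbs ≤ R := (supDist_le_iff.1 hz) i
    constructor
    · exact Int.ediv_le_ediv hM' (by omega)
    · exact Int.ediv_le_ediv hM' (by omega)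

/-- The packing statement PULLED BACK along any map `e : Y → ℤ^ν` (unit-lattice sites of a finite volume embedded in
`ℤ^ν`; cells `gridCellOf M ∘ e`; distance `supDistOn e`; radius `R` with `2R ≤ M`). [folklore] -/
theorem packing_comap {M R : ℕ} (hM : 0 < M) (h2R : 2 * R ≤ M) (e : Y → (Fin ν → ℤ)) (a : Y) :
    ∃ S : Finset (Fin ν → ℤ), S.card ≤ 2 ^ ν ∧ ∀ z : Y, supDistOn e a z ≤ R → gridCellOf M (e z) ∈ S := by
  obtain ⟨S, hS, hmem⟩ := gridCell_packing hM h2R (e a)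
  refine ⟨S, hS, fun z hz => hmem (e z) ?_⟩
  unfold supDistOn at hz
  exact_mod_cast hz

/-- **THE TUBE COUNT ON THE GRID**: sites `Y` mapped into `ℤ^ν` by `e`, decoration cells of side `M_d`, cube
neighbourhoods of `supDistOn e`-diameter `≤ D` with `D < ⌊M_d/2⌋`: for every admissible chain,
`#tubeDec ≤ 2^ν·(1 + pathLen/(⌊M_d/2⌋ − D))`. [folklore] -/
theorem card_tubeDec_grid_le {Md : ℕ} (hMd : 0 < Md) (e : Y → (Fin ν → ℤ)) (E : B → Finset Y) {D : ℝ}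
    (hdiam : ∀ b, ∀ z ∈ E b, ∀ z' ∈ E b, supDistOn e z z' ≤ D) (hD : D < (Md / 2 : ℕ))
    {n : ℕ} (bs : Fin (n + 1) → B) (y : Fin (n + 1) → Y) (hy : ∀ t, y t ∈ E (bs t)) :
    ((tubeDec (fun z => gridCellOf Md (e z)) E n bs).card : ℝ)
      ≤ (2 ^ ν : ℕ) * (1 + pathLen (supDistOn e) n y / (((Md / 2 : ℕ) : ℝ) - D)) := by
  have hw := weightHyp_supDistOn e le_rfl (κ := 0)
  have h2R : 2 * (Md / 2) ≤ Md := Nat.mul_div_le Md 2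
  exact card_tubeDec_le (supDistOn e) hw.tri hw.zero hw.nonneg (r := ((Md / 2 : ℕ) : ℝ) - D) (D := D)
    (R := ((Md / 2 : ℕ) : ℝ)) (by linarith) (by linarith) (fun z => gridCellOf Md (e z))
    (fun a => packing_comap hMd h2R e a) E hdiam bs y hy

end Grid

end

end Summit.QuantumFields.BalabanUV.Beta.UnitLatticeTubeCount
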